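import Summits.AtomisticToContinuum.Crystallization.Theorems.FrustratedLawDichotomyStrainedPatchTaylorKbandKit

/-!
# (N) `KbandCert` PROVED: the 11-band second-derivative certificate for `W₄₅`, hence (P2a) and `TaylorTwoBent1 ⟸ BeyondBallTail` (lens-5 g53, crux 27623 T-side)

The table: 24 sub-bands (17 bump, 3 pure-LJ, 3 window, 1 far; instrument `scripts/kbandlean53.py` = exact rational replicas of the kit's numeric
hypotheses, greedy widest sub-band on a 1/200 grid), each ONE application of a generic band lemma of `…TaylorKbandKit` discharged by `norm_num`;
glued per band (`band_k0 … band_k9`) and assembled along the `if`-chain of `Kband` into ★★ `kbandCert_holds : KbandCert` (the last band `r ≥ 47/10`,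
`K = 0`, is the far regime).  CONSEQUENCES for node (T2-bent₁): `pairChord_holds : PairChord`, `matchedTaylor_holds : MatchedTaylor` ((P2a) PROVED), and
the node's seam with every analytic piece discharged: ★★★ `taylorTwoBent1_of_tail : BeyondBallTail → TaylorTwoBent1` — the ONLY remaining leaf of
(T2-bent₁) is the geometric tail (P3b) `BeyondBallTail` (cap-packing lemma).
-/

open scoped BigOperators Classical
open Summit.AtomisticToContinuum.Crystallization.Theorems.FrustratedLawDichotomyRangeCut (Sep)
open Summit.AtomisticToContinuum.Crystallization.Theorems.FrustratedLawDichotomyMotifLemmas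
open Summit.AtomisticToContinuum.Crystallization.Theorems.FrustratedLawDichotomyAveragingCut
open Summit.AtomisticToContinuum.Crystallization.Theorems.FrustratedLawDichotomyAveragingRuleCap
open Summit.AtomisticToContinuum.Crystallization.Theorems.FrustratedLawDichotomyAveragingRuleTightFree
open Summit.AtomisticToContinuum.Crystallization.Theorems.FrustratedLawDichotomyExemptAbsorptionRecord
open Summit.AtomisticToContinuum.Crystallization.Theorems.FrustratedLawDichotomySchurCut
open Literature.MathematicalPhysics.StatisticalMechanics (lennardJones lennardJones_nonpos)
open Summit.AtomisticToContinuum.Crystallization.Theorems.FrustratedLawDichotomyRuleToolkitGood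
open Summit.AtomisticToContinuum.Crystallization.Theorems.FrustratedLawDichotomyStrainedPatchHomSplit
open Summit.AtomisticToContinuum.Crystallization.Theorems.FrustratedLawDichotomyStrainedPatchHomTermCalculus
open Summit.AtomisticToContinuum.Crystallization.Theorems.FrustratedLawDichotomyStrainedPatchChartFamilies
open Summit.AtomisticToContinuum.Crystallization.Theorems.FrustratedLawDichotomyStrainedPatchChartFamiliesBent
open Summit.AtomisticToContinuum.Crystallization.Theorems.FrustratedLawDichotomyStrainedPatchChartFamiliesPinned
open Summit.AtomisticToContinuum.Crystallization.Theorems.FrustratedLawDichotomyStrainedPatchEnvelopeLaw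
open Summit.AtomisticToContinuum.Crystallization.Theorems.FrustratedLawDichotomyStrainedPatchEnvelopeTaylor

open Summit.AtomisticToContinuum.Crystallization.Theorems.FrustratedLawDichotomyStrainedPatchTaylorSplit
open Summit.AtomisticToContinuum.Crystallization.Theorems.FrustratedLawDichotomyStrainedPatchTaylorPair
open Summit.AtomisticToContinuum.Crystallization.Theorems.FrustratedLawDichotomyStrainedPatchTaylorChord

open Summit.AtomisticToContinuum.Crystallization.Theorems.FrustratedLawDichotomyStrainedPatchTaylorLeaves

open Summit.AtomisticToContinuum.Crystallization.Theorems.FrustratedLawDichotomyStrainedPatchTaylorLeaves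
open Summit.AtomisticToContinuum.Crystallization.Theorems.FrustratedLawDichotomyStrainedPatchTaylorRegular
open Summit.AtomisticToContinuum.Crystallization.Theorems.FrustratedLawDichotomyStrainedPatchTaylorKbandKit

namespace Summit.AtomisticToContinuum.Crystallization.Theorems.FrustratedLawDichotomyStrainedPatchTaylorKband

/-! ## §1. The table: 24 sub-bands (instrument `scripts/kbandlean53.py`, exact rational replicas of the hypotheses) -/

/-- Sub-band `[69821/100000, 9/10]` (bump regime), `K = 2700`. [formal bookkeeping] -/
theorem sb_k0_1 : BandOK (69821 / 100000) (9 / 10) 2700 := bump_band (by norm_num [S1, S2])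

/-- Band k0: `r ∈ [7/10, 4/5)`, `s ∈ [69821/100000, 9/10]`, `K = 2700`. [formal bookkeeping] -/
theorem band_k0 : BandOK (69821 / 100000) (9 / 10) 2700 := sb_k0_1

/-- Sub-band `[7/10, 19/20]` (bump regime), `K = 2146`. [formal bookkeeping] -/
theorem sb_k1_1 : BandOK (7 / 10) (19 / 20) 2146 := bump_band (by norm_num [S1, S2])

/-- Band k1: `r ∈ [4/5, 17/20)`, `s ∈ [7/10, 19/20]`, `K = 2146`. [formal bookkeeping] -/
theorem band_k1 : BandOK (7 / 10) (19 / 20) 2146 := sb_k1_1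

/-- Sub-band `[3/4, 1]` (bump regime), `K = 792`. [formal bookkeeping] -/
theorem sb_k2_1 : BandOK (3 / 4) 1 792 := bump_band (by norm_num [S1, S2])

/-- Band k2: `r ∈ [17/20, 9/10)`, `s ∈ [3/4, 1]`, `K = 792`. [formal bookkeeping] -/
theorem band_k2 : BandOK (3 / 4) 1 792 := sb_k2_1

/-- Sub-band `[4/5, 21/20]` (bump regime), `K = 304`. [formal bookkeeping] -/
theorem sb_k3_1 : BandOK (4 / 5) (21 / 20) 304 := bump_band (by norm_num [S1, S2])

/-- Band k3: `r ∈ [9/10, 19/20)`, `s ∈ [4/5, 21/20]`, `K = 304`. [formal bookkeeping] -/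
theorem band_k3 : BandOK (4 / 5) (21 / 20) 304 := sb_k3_1

/-- Sub-band `[17/20, 41/40]` (bump regime), `K = 121`. [formal bookkeeping] -/
theorem sb_k4_1 : BandOK (17 / 20) (41 / 40) 121 := bump_band (by norm_num [S1, S2])

/-- Sub-band `[41/40, 23/20]` (bump regime), `K = 121`. [formal bookkeeping] -/
theorem sb_k4_2 : BandOK (41 / 40) (23 / 20) 121 := bump_band (by norm_num [S1, S2])

/-- Band k4: `r ∈ [19/20, 21/20)`, `s ∈ [17/20, 23/20]`, `K = 121`. [formal bookkeeping] -/
theorem band_k4 : BandOK (17 / 20) (23 / 20) 121 := sb_k4_1.union sb_k4_2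

/-- Sub-band `[19/20, 201/200]` (bump regime), `K = 20`. [formal bookkeeping] -/
theorem sb_k5_1 : BandOK (19 / 20) (201 / 200) 20 := bump_band (by norm_num [S1, S2])

/-- Sub-band `[201/200, 13/10]` (bump regime), `K = 20`. [formal bookkeeping] -/
theorem sb_k5_2 : BandOK (201 / 200) (13 / 10) 20 := bump_band (by norm_num [S1, S2])

/-- Band k5: `r ∈ [21/20, 6/5)`, `s ∈ [19/20, 13/10]`, `K = 20`. [formal bookkeeping] -/
theorem band_k5 : BandOK (19 / 20) (13 / 10) 20 := sb_k5_1.union sb_k5_2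

/-- Sub-band `[11/10, 113/100]` (bump regime), `K = 1`. [formal bookkeeping] -/
theorem sb_k6_1 : BandOK (11 / 10) (113 / 100) 1 := bump_band (by norm_num [S1, S2])

/-- Sub-band `[113/100, 231/200]` (bump regime), `K = 1`. [formal bookkeeping] -/
theorem sb_k6_2 : BandOK (113 / 100) (231 / 200) 1 := bump_band (by norm_num [S1, S2])

/-- Sub-band `[231/200, 59/50]` (bump regime), `K = 1`. [formal bookkeeping] -/
theorem sb_k6_3 : BandOK (231 / 200) (59 / 50) 1 := bump_band (by norm_num [S1, S2])

/-- Sub-band `[59/50, 121/100]` (bump regime), `K = 1`. [formal bookkeeping] -/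
theorem sb_k6_4 : BandOK (59 / 50) (121 / 100) 1 := bump_band (by norm_num [S1, S2])

/-- Sub-band `[121/100, 251/200]` (bump regime), `K = 1`. [formal bookkeeping] -/
theorem sb_k6_5 : BandOK (121 / 100) (251 / 200) 1 := bump_band (by norm_num [S1, S2])

/-- Sub-band `[251/200, 11/8]` (bump regime), `K = 1`. [formal bookkeeping] -/
theorem sb_k6_6 : BandOK (251 / 200) (11 / 8) 1 := bump_band (by norm_num [S1, S2])

/-- Sub-band `[11/8, 8/5]` (bump regime), `K = 1`. [formal bookkeeping] -/
theorem sb_k6_7 : BandOK (11 / 8) (8 / 5) 1 := bump_band (by norm_num [S1, S2])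

/-- Band k6: `r ∈ [6/5, 3/2)`, `s ∈ [11/10, 8/5]`, `K = 1`. [formal bookkeeping] -/
theorem band_k6 : BandOK (11 / 10) (8 / 5) 1 := (((((sb_k6_1.union sb_k6_2).union sb_k6_3).union sb_k6_4).union sb_k6_5).union sb_k6_6).union sb_k6_7

/-- Sub-band `[7/5, 8/5]` (bump regime), `K = 1/2`. [formal bookkeeping] -/
theorem sb_k7_1 : BandOK (7 / 5) (8 / 5) (1 / 2) := bump_band (by norm_num [S1, S2])

/-- Sub-band `[8/5, 21/10]` (lj regime), `K = 1/2`. [formal bookkeeping] -/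
theorem sb_k7_2 : BandOK (8 / 5) (21 / 10) (1 / 2) := lj_band (by norm_num)

/-- Band k7: `r ∈ [3/2, 2)`, `s ∈ [7/5, 21/10]`, `K = 1/2`. [formal bookkeeping] -/
theorem band_k7 : BandOK (7 / 5) (21 / 10) (1 / 2) := sb_k7_1.union sb_k7_2

/-- Sub-band `[19/10, 3]` (lj regime), `K = 1/20`. [formal bookkeeping] -/
theorem sb_k8_1 : BandOK (19 / 10) 3 (1 / 20) := lj_band (by norm_num)

/-- Sub-band `[3, 31/10]` (window regime), `K = 1/20`. [formal bookkeeping] -/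
theorem sb_k8_2 : BandOK 3 (31 / 10) (1 / 20) := window_band_lo (by norm_num)

/-- Band k8: `r ∈ [2, 3)`, `s ∈ [19/10, 31/10]`, `K = 1/20`. [formal bookkeeping] -/
theorem band_k8 : BandOK (19 / 10) (31 / 10) (1 / 20) := sb_k8_1.union sb_k8_2

/-- Sub-band `[29/10, 3]` (lj regime), `K = 1/500`. [formal bookkeeping] -/
theorem sb_k9_1 : BandOK (29 / 10) 3 (1 / 500) := lj_band (by norm_num)

/-- Sub-band `[3, 81/25]` (window regime), `K = 1/500`. [formal bookkeeping] -/
theorem sb_k9_2 : BandOK 3 (81 / 25) (1 / 500) := window_band_lo (by norm_num)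

/-- Sub-band `[81/25, 15/4]` (window regime), `K = 1/500`. [formal bookkeeping] -/
theorem sb_k9_3 : BandOK (81 / 25) (15 / 4) (1 / 500) := window_band_lo (by norm_num)

/-- Sub-band `[15/4, 9/2]` (window regime), `K = 1/500`. [formal bookkeeping] -/
theorem sb_k9_4 : BandOK (15 / 4) (9 / 2) (1 / 500) := window_band_hi (by norm_num)

/-- Sub-band `[9/2, 24/5]` (far regime), `K = 1/500`. [formal bookkeeping] -/
theorem sb_k9_5 : BandOK (9 / 2) (24 / 5) (1 / 500) := far_band (by norm_num)

/-- Band k9: `r ∈ [3, 47/10)`, `s ∈ [29/10, 24/5]`, `K = 1/500`. [formal bookkeeping] -/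
theorem band_k9 : BandOK (29 / 10) (24 / 5) (1 / 500) := (((sb_k9_1.union sb_k9_2).union sb_k9_3).union sb_k9_4).union sb_k9_5

/-! ## §2. (N) `KbandCert` proved -/

/-- ★★ **(N) PROVED**: the 11-band certificate for `W₄₅`. [folklore] -/
theorem kbandCert_holds : KbandCert := by
  intro r s hr hlo hhi hJ
  have hA : r - 1 / 10 ≤ s := (le_max_left _ _).trans hlo
  have hB : (69821 / 100000 : ℝ) ≤ s := (le_max_right _ _).trans hlo
  unfold Kband
  split_ifs with h1 h2 h3 h4 h5 h6 h7 h8 h9 h10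
  · exact band_k0 s hB (by linarith) hJ
  · exact band_k1 s (by linarith) (by linarith) hJ
  · exact band_k2 s (by linarith) (by linarith) hJ
  · exact band_k3 s (by linarith) (by linarith) hJ
  · exact band_k4 s (by linarith) (by linarith) hJ
  · exact band_k5 s (by linarith) (by linarith) hJ
  · exact band_k6 s (by linarith) (by linarith) hJ
  · exact band_k7 s (by linarith) (by linarith) hJ
  · exact band_k8 s (by linarith) (by linarith) hJ
  · exact band_k9 s (by linarith) (by linarith) hJ
  · exact far_band (lo := 23 / 5) (hi := s) ⟨by norm_num, le_rfl⟩ s (by linarith) le_rfl hJ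

/-! ## §3. Consequences for node (T2-bent₁) -/

/-- (P2a-core) the pair chord lemma, unconditionally. [folklore] -/
theorem pairChord_holds : PairChord := pairChord_of_kband kbandCert_holds

/-- ★★ (P2a) `MatchedTaylor` PROVED. [folklore] -/
theorem matchedTaylor_holds : MatchedTaylor := matchedTaylor_of_pairChord pairChord_holds

/-- ★★★ THE (T2-bent₁) SEAM with every analytic piece discharged: `BeyondBallTail → TaylorTwoBent1`. [folklore] -/
theorem taylorTwoBent1_of_tail (h3b : BeyondBallTail) : TaylorTwoBent1 := taylorTwoBent1_of_NT kbandCert_holds h3b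

end Summit.AtomisticToContinuum.Crystallization.Theorems.FrustratedLawDichotomyStrainedPatchTaylorKband
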